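import Literature.Topology.FourManifolds.HostC
import HarnessLib

/-!
# The second segment conjugation and the second twist: the transported frame onto the rail frame

Topic `Literature/Topology/FourManifolds` (trunk T-4MAN). Fact seat
`provefact-Literature.Topology.FourManifolds.Knot.IsConnectedSum.isIsotopic` (Schubert's theorem),
geometric heart for rail knots, last conjugation. On the circle of the transported datum `c'` we
have two clear wall frames: the transported frame `frameC₁` (`HostC.wallRefC`, host `hostC ≃ R ∘ B`
by `HostC.isIsotopic_hostC`) and the spiked rail frame of `c'` (`H₁.hostHyp.wallRef`, host
`≃ A_{c'} = R ∘ B` by `HostToSummand.isIsotopic_host_A`). Hence the hosts are isotopic, by an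
ambient isotopy `Ψ₂` fixing the common straight host segment point for point (the **second
segment data** `segData₂`, `o = o'`, `d = d'`); the generic frame (`SegFrame.lean`) gives
`bentᶜ ≃ outTwo` (unit re-inserted by `L₂ = DΦ₂(o)`, `L₂ d = d`, `det L₂ > 0`); the twist lemma
(`TwistPath.lean`) applied to the rail bent knot of `c'` gives `bent_{c'} ≃ twOut₂`; and
`outTwo = twOut₂` point for point (`outTwo_eq_twOut₂`). Result: **the bent knot of `c'` over the
transported frame is isotopic to the bent knot of `c'` over its rail frame**
(`isIsotopic_bentC_bentRail`).

Everything is proved; no named facts are introduced.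

## References

* M. W. Hirsch, *Differential Topology*, GTM 33 (1976), Ch. 8 §1, Thm. 1.3. [HirschDT1976]
-/

open scoped Manifold ContDiff Topology Real
open Function Set Metric Filter

noncomputable section

namespace Literature.Topology.FourManifolds

/-- Local notation: `𝔼 n` is the model Euclidean space `EuclideanSpace ℝ (Fin n)`. -/
local notation "𝔼 " n:arg => EuclideanSpace ℝ (Fin n)

/-- Local notation: `𝕊 n` is the unit sphere in `EuclideanSpace ℝ (Fin (n + 1))`. -/
local notation "𝕊 " n:arg => (Metric.sphere (0 : EuclideanSpace ℝ (Fin (n + 1))) 1)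

attribute [local instance] fact_finrank_euclideanSpace_succ

open KnotsInBall ExitBend SegmentConj ModelTemplate TwistPath

/-- The end stage of the trivial ambient isotopy is the identity. [folklore] -/
theorem SegmentConj.stageOne_refl (x : 𝕊 3) : stageOne (AmbientIsotopy.refl : AmbientIsotopy (𝓡 3) (𝕊 3)) x = x := by
  rw [stageOne, AmbientIsotopy.coe_toDiffeomorph, AmbientIsotopy.refl_toFun]; rfl

namespace BandData

/-! ### The identity segment data of a wall reference -/

namespace WallRef

variable {A B K : Knot} {b : BandData A B K ∅}
  {hcross : b.band ⁻¹' sphereEquator 2 ∩ squareNhd b.δ = {x ∈ squareNhd b.δ | x 0 = 2⁻¹}}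
  {ε r A' κ : ℝ} {F : ℝ → 𝔼 4} (W : b.WallRef hcross ε r A' κ F)

/-- **The identity segment data**: trivial isotopy, the straight host segment onto itself. [folklore] -/
def segDataId : SegData where
  Ψ := AmbientIsotopy.refl
  o := W.segO
  o' := W.segO
  d := W.segD
  d' := W.segD
  ρlo := -1
  ρhi := 1 / 2
  d_ne := W.segD_ne_zero
  ρlo_neg := by norm_num
  ρhi_pos := by norm_num
  seg ρ _ := SegmentConj.stageOne_refl _

/-- The trivial isotopy fixes the reference host. [folklore] -/
theorem stageOne_segDataId_host (x : 𝕊 1) : stageOne W.segDataId.Ψ (W.host x) = W.host x := SegmentConj.stageOne_refl _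

/-- **THE FAR RADIUS OF THE REFERENCE HOST**: reference host points of parameters off the open
straight range `(strLo, winHi)` are the north pole or at chart distance `≥ R₁ > 0` from the segment
centre `o`. [folklore] -/
theorem exists_far_radius_host : ∃ R₁ > 0, ∀ t ∈ Icc b.alo (b.alo + 1), t ∉ Ioo (b.strLo W.HU) (b.winHi W.HU WallRef.half_mem) →
    W.host (circlePt t) = northPole ∨ R₁ ≤ ‖psiN (W.host (circlePt t)) - W.segO‖ := by
  set H := W.host with hH
  have hl2 : (1 / 2 : ℝ) ≤ 1 / 2 := le_rfl
  obtain ⟨m1, m2, m3, m3', m4, m5⟩ := b.str_marks W.HU WallRef.half_mem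
  have hcm := b.core_marks
  have hwc := b.winHi_mem_core W.HU WallRef.half_mem
  have hlc := b.parLo_mem_core W.κ_pos W.HU.cone.spike.seven_le_gapLo quarter_mem7
  have hε := b.epsLo_bounds.1
  obtain ⟨t₀, ht₀, ht₀v⟩ := b.exists_clockFn_eq' W.HU WallRef.half_mem hl2 (ρ := 0) ⟨by norm_num, by norm_num⟩
  obtain ⟨v1, -⟩ := b.clockFn_strLo_strHi W.HU WallRef.half_mem hl2
  have v2 := b.clockFn_winHi W.HU WallRef.half_mem hl2
  have ht₀1 : b.strLo W.HU < t₀ := lt_of_le_of_ne ht₀.1 fun h ↦ by rw [← h, v1] at ht₀v; norm_num at ht₀v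
  have ht₀2 : t₀ < b.winHi W.HU WallRef.half_mem := lt_of_le_of_ne ht₀.2 fun h ↦ by rw [h, v2] at ht₀v; norm_num at ht₀v
  have hx₀ : H (circlePt t₀) = psiN.symm W.segO := by
    rw [hH, W.host_straight ht₀]
    have : b.clockFn W.HU WallRef.half_mem (by norm_num) t₀ = 0 := ht₀v
    rw [this, zero_smul, add_zero]
  have halo : b.alo < b.strLo W.HU := by
    have : b.strLo W.HU = b.parLo W.κ_pos W.HU.cone.spike.seven_le_gapLo quarter_mem7 := rfl
    linarith [hlc.1]
  have halo' : b.winHi W.HU WallRef.half_mem < b.alo + 1 := by linarith [hwc.2]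
  set T : Set ℝ := Icc b.alo (b.alo + 1) \ Ioo (b.strLo W.HU) (b.winHi W.HU WallRef.half_mem) with hT'
  have hTc : IsCompact T := isCompact_Icc.diff isOpen_Ioo
  have hTne : T.Nonempty := ⟨b.alo, ⟨left_mem_Icc.2 (by linarith), fun h ↦ by linarith [h.1]⟩⟩
  set f : ℝ → 𝔼 4 := fun t ↦ ((H (circlePt t) : 𝕊 3) : 𝔼 4) with hf'
  have hfc : Continuous f := by
    have : f = Knot.curve H := funext fun t ↦ (Knot.curve_apply (K := H) t).symm
    rw [this]; exact H.continuous_curve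
  set g : ℝ → ℝ := fun t ↦ ‖f t - f t₀‖ with hg'
  have hgc : Continuous g := (hfc.sub continuous_const).norm
  have hpos : ∀ t ∈ T, 0 < g t := by
    intro t ht
    simp only [hg', norm_pos_iff, sub_ne_zero, hf']
    intro he
    have he' : Knot.curve H t = Knot.curve H t₀ := by rw [Knot.curve_apply, Knot.curve_apply]; exact he
    obtain ⟨m, hm⟩ := H.curve_eq_curve_iff.1 he'
    have h1 : (m : ℝ) < 1 := by linarith [ht.1.2]
    have h2 : (-1 : ℝ) < m := by linarith [ht.1.1]
    have h1' : m < 1 := by exact_mod_cast h1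
    have h2' : -1 < m := by exact_mod_cast h2
    have hm0 : m = 0 := by omega
    rw [hm0, Int.cast_zero, add_zero] at hm
    exact ht.2 ⟨by rw [hm]; exact ht₀1, by rw [hm]; exact ht₀2⟩
  obtain ⟨tm, htm, hmin⟩ := hTc.exists_isMinOn hTne hgc.continuousOn
  set m := g tm with hm'
  have hm0 : 0 < m := hpos tm htm
  have hcs : Continuous fun y : 𝔼 3 ↦ ((psiN.symm y : 𝕊 3) : 𝔼 4) := contDiff_coe_psiN_symm.continuous
  obtain ⟨R₁, hR₁, hR⟩ := Metric.continuousAt_iff.1 (hcs.continuousAt (x := W.segO)) m hm0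
  refine ⟨R₁, hR₁, fun t ht hts ↦ ?_⟩
  by_cases hN : H (circlePt t) = northPole
  · exact Or.inl hN
  · right
    by_contra hlt
    push Not at hlt
    have h1 := hR (by rw [dist_eq_norm]; exact hlt)
    rw [psiN_symm_apply_psiN hN, dist_eq_norm] at h1
    have h2 : m ≤ g t := hmin ⟨ht, hts⟩
    have e : ((psiN.symm W.segO : 𝕊 3) : 𝔼 4) = f t₀ := by simp only [hf']; rw [hx₀]
    rw [e] at h1
    exact absurd h2 (not_le.2 h1)

end WallRef

namespace FlatHyp

section Two

variable {A B K K' : Knot} {b : BandData A B K ∅} {b' : BandData A B K' ∅}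
  {c : BandData (B.map (reflectLastDiffeo 3)) (A.map (reflectLastDiffeo 3)) (K.map (reflectLastDiffeo 3)) ∅}
  {c' : BandData (B.map (reflectLastDiffeo 3)) (A.map (reflectLastDiffeo 3)) (K'.map (reflectLastDiffeo 3)) ∅}
  {hcross : b.band ⁻¹' sphereEquator 2 ∩ squareNhd b.δ = {x ∈ squareNhd b.δ | x 0 = 2⁻¹}}
  {hcross' : b'.band ⁻¹' sphereEquator 2 ∩ squareNhd b'.δ = {x ∈ squareNhd b'.δ | x 0 = 2⁻¹}}
  {hcrossc₀ : c.band ⁻¹' sphereEquator 2 ∩ squareNhd c.δ = {x ∈ squareNhd c.δ | x 0 = 2⁻¹}}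
  {hcrossc : c'.band ⁻¹' sphereEquator 2 ∩ squareNhd c'.δ = {x ∈ squareNhd c'.δ | x 0 = 2⁻¹}}
  {ε r A' εc rc ε' r' κ : ℝ} (Hb : FlatHyp hcross hcrossc₀ ε r A' εc rc ε' r' κ)
  {ε₁ r₁ A₁' ε₂ r₂ ε₁' r₁' κ₁ : ℝ} (H₁ : FlatHyp hcrossc hcross' ε₁ r₁ A₁' ε₂ r₂ ε₁' r₁' κ₁)
  (Hball : ∀ κ', 0 < κ' → κ' ≤ κ → FlatHyp hcross hcrossc₀ ε r A' εc rc ε' r' κ')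
  (H₁all : ∀ κ', 0 < κ' → κ' ≤ κ₁ → FlatHyp hcrossc hcross' ε₁ r₁ A₁' ε₂ r₂ ε₁' r₁' κ')
  (hsmall : ∀ s, ‖κ₁ • c'.frame hcrossc (template c'.depthSign s)‖ ≤ 1 / 2)
  {εf rf : ℝ} (hf : b.IsFlat hcross εf rf) (hεf : εf ≤ HostHyp.epsU) (hrf : 4 * κ < rf) (hκt : κ * tgtLip ≤ 1)
  {ρ₂ R₀ lam₀ rA : ℝ} (U : (Hb.wallRef zero_mem01).UnitScale ρ₂ R₀ lam₀ rA) (hρ4 : ρ₂ ≤ 1 / 4)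
  {R₁ rc₁ R₃ rc₃ : ℝ}
  (hfar₁ : ∀ t ∈ Icc b.alo (b.alo + 1), t ∉ Ioo (b.strLo Hb.HU) (b.winHi Hb.HU WallRef.half_mem) →
    chordH Hb.hostHyp H₁.pair H₁.HU H₁.arc H₁.pairScale H₁.flat H₁.eps_le H₁.five_lt (circlePt t) = northPole ∨
      R₁ ≤ ‖psiN (chordH Hb.hostHyp H₁.pair H₁.HU H₁.arc H₁.pairScale H₁.flat H₁.eps_le H₁.five_lt (circlePt t)) - chordO H₁.arc‖)
  (hS₁ : (segData₁ Hb H₁ hf hεf hrf hκt).Small (-ρ₂) ρ₂ R₀ R₁ rc₁)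
  (hfar₃ : ∀ t ∈ Icc b.alo (b.alo + 1), t ∉ Ioo (b.strLo Hb.HU) (b.winHi Hb.HU WallRef.half_mem) →
    chordH₃ Hb H₁ (circlePt t) = northPole ∨ R₃ ≤ ‖psiN (chordH₃ Hb H₁ (circlePt t)) - chordO H₁.arc‖)
  (hS₃ : (segData₃ Hb H₁ Hball H₁all hsmall).Small (-ρ₂) ρ₂ R₀ R₃ rc₃)
  (hR0 : ‖(((segData₃ Hb H₁ Hball H₁all hsmall).L : (𝔼 3) ≃L[ℝ] 𝔼 3) : (𝔼 3) →L[ℝ] 𝔼 3)‖ * R₀ ≤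
    (U.twData (segData₃ Hb H₁ Hball H₁all hsmall) hS₃ (L₁_d Hb H₁ Hball H₁all hsmall hf hεf hrf hκt)
      (det_L₁_pos Hb H₁ hf hεf hrf hκt)).R₀)
  (hW : c'.IsWallFrame H₁.HU.cone (frameC₁ Hb H₁ hf hεf hrf hκt U hρ4 hfar₁ hS₁))
  (hclear : c'.IsBendClear H₁.HU.cone (frameC₁ Hb H₁ hf hεf hrf hκt U hρ4 hfar₁ hS₁))
  (hBA : B = (B.map (reflectLastDiffeo 3)).map (reflectLastDiffeo 3))
  {εf' rf' : ℝ} (hf' : c'.IsFlat hcrossc εf' rf') (hεf' : εf' ≤ HostHyp.epsU) (hrf' : 4 * κ₁ < rf') (hκt' : κ₁ * tgtLip ≤ 1)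

/-! ### The second segment data -/

include Hball H₁all hsmall hfar₃ hS₃ hR0 hBA hf' hεf' hrf' hκt' in
/-- **THE HOST OVER THE TRANSPORTED FRAME IS ISOTOPIC TO THE RAIL REFERENCE HOST OF `c'`** (both are
isotopic to `A_{c'} = R ∘ B`). [cite: HirschDT1976, Ch. 8 §1, Thm. 1.3] -/
theorem isIsotopic_hostC_hostRail :
    (hostC Hb H₁ hf hεf hrf hκt U hρ4 hfar₁ hS₁ hW hclear).IsIsotopic H₁.hostHyp.wallRef.host :=
  IsAmbientIsotopic.trans_holds (isIsotopic_hostC Hb H₁ Hball H₁all hsmall hf hεf hrf hκt U hρ4 hfar₁ hS₁ hfar₃ hS₃ hR0 hW hclear hBA)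
    (IsAmbientIsotopic.symm_holds (H₁.hostHyp.isIsotopic_host_A hf' hεf' hrf' hκt'))

include Hball H₁all hsmall hfar₃ hS₃ hR0 hBA hf' hεf' hrf' hκt' in
/-- Existence of the ambient isotopy of the second conjugation. [folklore] -/
theorem exists_Psi₂ : ∃ Ψ : AmbientIsotopy (𝓡 3) (𝕊 3),
    Ψ.toFun 1 ∘ ⇑(hostC Hb H₁ hf hεf hrf hκt U hρ4 hfar₁ hS₁ hW hclear) = ⇑(H₁.hostHyp.wallRef.host) :=
  isIsotopic_hostC_hostRail Hb H₁ Hball H₁all hsmall hf hεf hrf hκt U hρ4 hfar₁ hS₁ hfar₃ hS₃ hR0 hW hclear hBA hf' hεf' hrf' hκt'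

/-- **The ambient isotopy** `Ψ₂` with `Ψ₂,₁ ∘ hostC = host_{c'}`. [folklore] -/
def Psi₂ : AmbientIsotopy (𝓡 3) (𝕊 3) :=
  (exists_Psi₂ Hb H₁ Hball H₁all hsmall hf hεf hrf hκt U hρ4 hfar₁ hS₁ hfar₃ hS₃ hR0 hW hclear hBA hf' hεf' hrf' hκt').choose

/-- `Ψ₂,₁ ∘ hostC = host_{c'}`. [folklore] -/
theorem Psi₂_hostC (x : 𝕊 1) :
    stageOne (Psi₂ Hb H₁ Hball H₁all hsmall hf hεf hrf hκt U hρ4 hfar₁ hS₁ hfar₃ hS₃ hR0 hW hclear hBA hf' hεf' hrf' hκt')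
      ((wallRefC Hb H₁ hf hεf hrf hκt U hρ4 hfar₁ hS₁ hW hclear).host x) = H₁.hostHyp.wallRef.host x := by
  have := congrFun (exists_Psi₂ Hb H₁ Hball H₁all hsmall hf hεf hrf hκt U hρ4 hfar₁ hS₁ hfar₃ hS₃ hR0 hW hclear hBA hf' hεf' hrf' hκt').choose_spec x
  rw [comp_apply] at this
  rw [← this, stageOne, AmbientIsotopy.coe_toDiffeomorph]
  rfl

/-- **THE SEGMENT DATA OF THE SECOND CONJUGATION** (`o = o'`, `d = d'`). [folklore] -/
def segData₂ : SegData where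
  Ψ := Psi₂ Hb H₁ Hball H₁all hsmall hf hεf hrf hκt U hρ4 hfar₁ hS₁ hfar₃ hS₃ hR0 hW hclear hBA hf' hεf' hrf' hκt'
  o := (wallRefC Hb H₁ hf hεf hrf hκt U hρ4 hfar₁ hS₁ hW hclear).segO
  o' := H₁.hostHyp.wallRef.segO
  d := (wallRefC Hb H₁ hf hεf hrf hκt U hρ4 hfar₁ hS₁ hW hclear).segD
  d' := H₁.hostHyp.wallRef.segD
  ρlo := -1
  ρhi := 1 / 2
  d_ne := (wallRefC Hb H₁ hf hεf hrf hκt U hρ4 hfar₁ hS₁ hW hclear).segD_ne_zero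
  ρlo_neg := by norm_num
  ρhi_pos := by norm_num
  seg ρ hρ := by
    obtain ⟨u, hu, huρ⟩ := c'.exists_clockFn_eq' H₁.HU WallRef.half_mem (by norm_num) hρ
    have e1 := (wallRefC Hb H₁ hf hεf hrf hκt U hρ4 hfar₁ hS₁ hW hclear).host_straight hu
    have e2 := H₁.hostHyp.wallRef.host_straight hu
    rw [← huρ]
    refine (congrArg _ e1.symm).trans ((Psi₂_hostC Hb H₁ Hball H₁all hsmall hf hεf hrf hκt U hρ4 hfar₁ hS₁ hfar₃ hS₃ hR0 hW hclear hBA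
      hf' hεf' hrf' hκt' _).trans e2)

/-- The fields of the second segment data. [folklore] -/
theorem segData₂_Ψ : (segData₂ Hb H₁ Hball H₁all hsmall hf hεf hrf hκt U hρ4 hfar₁ hS₁ hfar₃ hS₃ hR0 hW hclear hBA hf' hεf' hrf' hκt').Ψ =
    Psi₂ Hb H₁ Hball H₁all hsmall hf hεf hrf hκt U hρ4 hfar₁ hS₁ hfar₃ hS₃ hR0 hW hclear hBA hf' hεf' hrf' hκt' := rfl

/-- The end stage of the second conjugation on the host over the transported frame. [folklore] -/
theorem Psi₂_wallRefC_host (x : 𝕊 1) :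
    stageOne (segData₂ Hb H₁ Hball H₁all hsmall hf hεf hrf hκt U hρ4 hfar₁ hS₁ hfar₃ hS₃ hR0 hW hclear hBA hf' hεf' hrf' hκt').Ψ
      ((wallRefC Hb H₁ hf hεf hrf hκt U hρ4 hfar₁ hS₁ hW hclear).host x) = H₁.hostHyp.wallRef.host x :=
  Psi₂_hostC Hb H₁ Hball H₁all hsmall hf hεf hrf hκt U hρ4 hfar₁ hS₁ hfar₃ hS₃ hR0 hW hclear hBA hf' hεf' hrf' hκt' x

/-! ### The second conjugation -/

variable {ρ₂' R₀' lam₀' rA' : ℝ} (U₂ : (wallRefC Hb H₁ hf hεf hrf hκt U hρ4 hfar₁ hS₁ hW hclear).UnitScale ρ₂' R₀' lam₀' rA') (hρ4' : ρ₂' ≤ 1 / 4) {R₂ rc₂ : ℝ}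
  (hfar₂ : ∀ t ∈ Icc c'.alo (c'.alo + 1), t ∉ Ioo (c'.strLo H₁.HU) (c'.winHi H₁.HU WallRef.half_mem) →
    H₁.hostHyp.wallRef.host (circlePt t) = northPole ∨ R₂ ≤ ‖psiN (H₁.hostHyp.wallRef.host (circlePt t)) - H₁.hostHyp.wallRef.segO‖)
  (hS₂ : (segData₂ Hb H₁ Hball H₁all hsmall hf hεf hrf hκt U hρ4 hfar₁ hS₁ hfar₃ hS₃ hR0 hW hclear hBA hf' hεf' hrf' hκt').Small (-ρ₂') ρ₂' R₀' R₂ rc₂)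

/-- **THE OUTPUT KNOT OF THE SECOND CONJUGATION.** [folklore] -/
def outTwo : Knot :=
  U₂.outOne (segData₂ Hb H₁ Hball H₁all hsmall hf hεf hrf hκt U hρ4 hfar₁ hS₁ hfar₃ hS₃ hR0 hW hclear hBA hf' hεf' hrf' hκt') rfl rfl rfl rfl (Psi₂_wallRefC_host Hb H₁ Hball H₁all hsmall hf hεf hrf hκt U hρ4 hfar₁ hS₁ hfar₃ hS₃ hR0 hW hclear hBA hf' hεf' hrf' hκt') hρ4' hfar₂ hS₂

/-- **The bent knot over the transported frame is isotopic to the second output.**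
[cite: HirschDT1976, Ch. 8 §1, Thm. 1.3] -/
theorem isIsotopic_bentC_outTwo :
    ((wallRefC Hb H₁ hf hεf hrf hκt U hρ4 hfar₁ hS₁ hW hclear).bent U₂.hl₀ U₂.hrA).IsIsotopic (outTwo Hb H₁ Hball H₁all hsmall hf hεf hrf hκt U hρ4 hfar₁ hS₁ hfar₃ hS₃ hR0 hW hclear hBA hf' hεf' hrf' hκt' U₂ hρ4' hfar₂ hS₂) :=
  U₂.isIsotopic_bent_outOne (segData₂ Hb H₁ Hball H₁all hsmall hf hεf hrf hκt U hρ4 hfar₁ hS₁ hfar₃ hS₃ hR0 hW hclear hBA hf' hεf' hrf' hκt') rfl rfl rfl rfl (Psi₂_wallRefC_host Hb H₁ Hball H₁all hsmall hf hεf hrf hκt U hρ4 hfar₁ hS₁ hfar₃ hS₃ hR0 hW hclear hBA hf' hεf' hrf' hκt') hρ4' hfar₂ hS₂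

/-! ### The second twist: the rail bent knot of `c'` -/

/-- **The unit scale of the rail reference of `c'`**: the same numbers. [folklore] -/
theorem _root_.Literature.Topology.FourManifolds.BandData.WallRef.UnitScale.toRailC (U₂ : (wallRefC Hb H₁ hf hεf hrf hκt U hρ4 hfar₁ hS₁ hW hclear).UnitScale ρ₂' R₀' lam₀' rA') :
    H₁.hostHyp.wallRef.UnitScale ρ₂' R₀' lam₀' rA' :=
  ⟨U₂.hl₀, U₂.hl₀2, U₂.hrA, U₂.hrA8, U₂.rA_le, U₂.arc_le, U₂.small, U₂.gen_le, U₂.lam_lt⟩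

/-- **The twist data of the second conjugation**: the straight host segment of `c'`, the
linearisation `L₂` of `Ψ₂` (`L₂ d = d`, `det L₂ > 0`), clocks `[-ρ₂', ρ₂']`, far radius `R₂`. [folklore] -/
def twData₂ (_ : (wallRefC Hb H₁ hf hεf hrf hκt U hρ4 hfar₁ hS₁ hW hclear).UnitScale ρ₂' R₀' lam₀' rA') (hS₂ : (segData₂ Hb H₁ Hball H₁all hsmall hf hεf hrf hκt U hρ4 hfar₁ hS₁ hfar₃ hS₃ hR0 hW hclear hBA hf' hεf' hrf' hκt').Small (-ρ₂') ρ₂' R₀' R₂ rc₂) : TwData where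
  o := H₁.hostHyp.wallRef.segO
  d := H₁.hostHyp.wallRef.segD
  L := (((segData₂ Hb H₁ Hball H₁all hsmall hf hεf hrf hκt U hρ4 hfar₁ hS₁ hfar₃ hS₃ hR0 hW hclear hBA hf' hεf' hrf' hκt').L : (𝔼 3) ≃L[ℝ] 𝔼 3) : (𝔼 3) →L[ℝ] 𝔼 3)
  ρ₁ := -ρ₂'
  ρ₂ := ρ₂'
  R₁ := R₂
  d_ne := H₁.hostHyp.wallRef.segD_ne_zero
  L_d := (segData₂ Hb H₁ Hball H₁all hsmall hf hεf hrf hκt U hρ4 hfar₁ hS₁ hfar₃ hS₃ hR0 hW hclear hBA hf' hεf' hrf' hκt').L_d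
  det_pos := (segData₂ Hb H₁ Hball H₁all hsmall hf hεf hrf hκt U hρ4 hfar₁ hS₁ hfar₃ hS₃ hR0 hW hclear hBA hf' hεf' hrf' hκt').det_L_pos
  ρ₁_neg := by linarith [hS₂.ρ₂_pos]
  ρ₂_pos := hS₂.ρ₂_pos
  R₁_pos := hS₂.R₁_pos
  seg_far := hS₂.seg_far

include hfar₂ in
/-- **THE TWIST FRAME OF THE RAIL BENT KNOT OF `c'`** (unit radius small against the twist threshold).
[folklore] -/
def twFrame₂ (hR0' : R₀' ≤ (twData₂ Hb H₁ Hball H₁all hsmall hf hεf hrf hκt U hρ4 hfar₁ hS₁ hfar₃ hS₃ hR0 hW hclear hBA hf' hεf' hrf' hκt' U₂ hS₂).R₀) : (twData₂ Hb H₁ Hball H₁all hsmall hf hεf hrf hκt U hρ4 hfar₁ hS₁ hfar₃ hS₃ hR0 hW hclear hBA hf' hεf' hrf' hκt' U₂ hS₂).Frame where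
  I₀ := Knot.curve (H₁.hostHyp.wallRef.bent U₂.hl₀ U₂.hrA)
  a := c'.alo
  ε₀ := min ((WallRef.UnitScale.toRailC Hb H₁ hf hεf hrf hκt U hρ4 hfar₁ hS₁ hW hclear U₂).w₁ hρ4' - c'.alo) (c'.alo + 1 - (WallRef.UnitScale.toRailC Hb H₁ hf hεf hrf hκt U hρ4 hfar₁ hS₁ hW hclear U₂).w₂ hρ4') / 2
  w₁ := (WallRef.UnitScale.toRailC Hb H₁ hf hεf hrf hκt U hρ4 hfar₁ hS₁ hW hclear U₂).w₁ hρ4'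
  c₁ := (WallRef.UnitScale.toRailC Hb H₁ hf hεf hrf hκt U hρ4 hfar₁ hS₁ hW hclear U₂).c₁ hρ4'
  c₂ := (WallRef.UnitScale.toRailC Hb H₁ hf hεf hrf hκt U hρ4 hfar₁ hS₁ hW hclear U₂).c₂ hρ4'
  w₂ := (WallRef.UnitScale.toRailC Hb H₁ hf hεf hrf hκt U hρ4 hfar₁ hS₁ hW hclear U₂).w₂ hρ4'
  contDiff := (H₁.hostHyp.wallRef.bent U₂.hl₀ U₂.hrA).contDiff_curve
  isRegularLoop := by
    rw [periodise_eq_of_periodic _ (H₁.hostHyp.wallRef.bent U₂.hl₀ U₂.hrA).periodic_curve]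
    exact (H₁.hostHyp.wallRef.bent U₂.hl₀ U₂.hrA).isRegularLoop_curve
  injOn := (H₁.hostHyp.wallRef.bent U₂.hl₀ U₂.hrA).injOn_curve_Ico c'.alo
  ε₀_pos := by
    obtain ⟨h1, h2, -⟩ := (WallRef.UnitScale.toRailC Hb H₁ hf hεf hrf hκt U hρ4 hfar₁ hS₁ hW hclear U₂).window_marks' hρ4'
    exact div_pos (lt_min (by linarith) (by linarith)) (by norm_num)
  seam t _ := (H₁.hostHyp.wallRef.bent U₂.hl₀ U₂.hrA).periodic_curve t
  le_w₁ := by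
    obtain ⟨h1, h2, -⟩ := (WallRef.UnitScale.toRailC Hb H₁ hf hεf hrf hκt U hρ4 hfar₁ hS₁ hW hclear U₂).window_marks' hρ4'
    have := min_le_left ((WallRef.UnitScale.toRailC Hb H₁ hf hεf hrf hκt U hρ4 hfar₁ hS₁ hW hclear U₂).w₁ hρ4' - c'.alo) (c'.alo + 1 - (WallRef.UnitScale.toRailC Hb H₁ hf hεf hrf hκt U hρ4 hfar₁ hS₁ hW hclear U₂).w₂ hρ4')
    linarith
  w₁_lt := ((WallRef.UnitScale.toRailC Hb H₁ hf hεf hrf hκt U hρ4 hfar₁ hS₁ hW hclear U₂).window_marks hρ4').2.1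
  c₁_lt := ((WallRef.UnitScale.toRailC Hb H₁ hf hεf hrf hκt U hρ4 hfar₁ hS₁ hW hclear U₂).window_marks' hρ4').2.2
  c₂_lt := ((WallRef.UnitScale.toRailC Hb H₁ hf hεf hrf hκt U hρ4 hfar₁ hS₁ hW hclear U₂).window_marks hρ4').2.2.2.2.1
  w₂_le := by
    obtain ⟨h1, h2, -⟩ := (WallRef.UnitScale.toRailC Hb H₁ hf hεf hrf hκt U hρ4 hfar₁ hS₁ hW hclear U₂).window_marks' hρ4'
    have := min_le_right ((WallRef.UnitScale.toRailC Hb H₁ hf hεf hrf hκt U hρ4 hfar₁ hS₁ hW hclear U₂).w₁ hρ4' - c'.alo) (c'.alo + 1 - (WallRef.UnitScale.toRailC Hb H₁ hf hεf hrf hκt U hρ4 hfar₁ hS₁ hW hclear U₂).w₂ hρ4')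
    linarith
  collar s hs := (WallRef.UnitScale.toRailC Hb H₁ hf hεf hrf hκt U hρ4 hfar₁ hS₁ hW hclear U₂).collar hρ4' hs
  inner s hs := by
    rcases (WallRef.UnitScale.toRailC Hb H₁ hf hεf hrf hκt U hρ4 hfar₁ hS₁ hW hclear U₂).inner hρ4' hs with h | ⟨y, hy, he⟩
    · exact Or.inl h
    · right
      refine ⟨y, ?_, he⟩
      rw [mem_closedBall] at hy ⊢
      exact hy.trans hR0'
  off t ht hts := by
    rcases (WallRef.UnitScale.toRailC Hb H₁ hf hεf hrf hκt U hρ4 hfar₁ hS₁ hW hclear U₂).off H₁.hostHyp.wallRef.segDataId H₁.hostHyp.wallRef.stageOne_segDataId_host hρ4' hfar₂ ht hts with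
      ⟨ρ, -, hρn, he⟩ | ⟨x, hx, h⟩
    · exact Or.inl ⟨ρ, hρn, he⟩
    · right
      refine ⟨x, hx, ?_⟩
      have e : stageOne H₁.hostHyp.wallRef.segDataId.Ψ x = x := SegmentConj.stageOne_refl x
      rw [e] at h
      exact h

/-- **THE TWISTED RAIL BENT KNOT OF `c'`.** [folklore] -/
def twOut₂ (hR0' : R₀' ≤ (twData₂ Hb H₁ Hball H₁all hsmall hf hεf hrf hκt U hρ4 hfar₁ hS₁ hfar₃ hS₃ hR0 hW hclear hBA hf' hεf' hrf' hκt' U₂ hS₂).R₀) : Knot := (twFrame₂ Hb H₁ Hball H₁all hsmall hf hεf hrf hκt U hρ4 hfar₁ hS₁ hfar₃ hS₃ hR0 hW hclear hBA hf' hεf' hrf' hκt' U₂ hρ4' hfar₂ hS₂ hR0').outKnot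

/-- The base knot of the twist frame is the rail bent knot of `c'`. [folklore] -/
theorem baseKnot_twFrame₂ (hR0' : R₀' ≤ (twData₂ Hb H₁ Hball H₁all hsmall hf hεf hrf hκt U hρ4 hfar₁ hS₁ hfar₃ hS₃ hR0 hW hclear hBA hf' hεf' hrf' hκt' U₂ hS₂).R₀) :
    (twFrame₂ Hb H₁ Hball H₁all hsmall hf hεf hrf hκt U hρ4 hfar₁ hS₁ hfar₃ hS₃ hR0 hW hclear hBA hf' hεf' hrf' hκt' U₂ hρ4' hfar₂ hS₂ hR0').baseKnot = H₁.hostHyp.wallRef.bent U₂.hl₀ U₂.hrA := by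
  set Fr := twFrame₂ Hb H₁ Hball H₁all hsmall hf hεf hrf hκt U hρ4 hfar₁ hS₁ hfar₃ hS₃ hR0 hW hclear hBA hf' hεf' hrf' hκt' U₂ hρ4' hfar₂ hS₂ hR0'
  set O := H₁.hostHyp.wallRef.bent U₂.hl₀ U₂.hrA
  apply DFunLike.coe_injective
  funext u
  obtain ⟨t, ht, htu⟩ := O.exists_mem_Ico_apply_circlePt_eq c'.alo (x := O u) ⟨u, rfl⟩
  have hu : circlePt t = u := O.injective htu
  rw [← hu]
  apply Subtype.ext
  rw [Fr.coe_baseKnot_circlePt (show t ∈ Ico Fr.a (Fr.a + 1) from ht)]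
  show Knot.curve O t = _
  rw [Knot.curve_apply]

/-- **The rail bent knot of `c'` is isotopic to its twist.** [cite: HirschDT1976, Ch. 8 §1, Thm. 1.3] -/
theorem isIsotopic_bentRail_twOut₂ (hR0' : R₀' ≤ (twData₂ Hb H₁ Hball H₁all hsmall hf hεf hrf hκt U hρ4 hfar₁ hS₁ hfar₃ hS₃ hR0 hW hclear hBA hf' hεf' hrf' hκt' U₂ hS₂).R₀) :
    (H₁.hostHyp.wallRef.bent U₂.hl₀ U₂.hrA).IsIsotopic (twOut₂ Hb H₁ Hball H₁all hsmall hf hεf hrf hκt U hρ4 hfar₁ hS₁ hfar₃ hS₃ hR0 hW hclear hBA hf' hεf' hrf' hκt' U₂ hρ4' hfar₂ hS₂ hR0') := by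
  have h := (twFrame₂ Hb H₁ Hball H₁all hsmall hf hεf hrf hκt U hρ4 hfar₁ hS₁ hfar₃ hS₃ hR0 hW hclear hBA hf' hεf' hrf' hκt' U₂ hρ4' hfar₂ hS₂ hR0').isIsotopic_baseKnot_outKnot
  rwa [baseKnot_twFrame₂] at h

/-- The twisted knot off the window is the rail bent knot. [folklore] -/
theorem twOut₂_circlePt_of_not_mem (hR0' : R₀' ≤ (twData₂ Hb H₁ Hball H₁all hsmall hf hεf hrf hκt U hρ4 hfar₁ hS₁ hfar₃ hS₃ hR0 hW hclear hBA hf' hεf' hrf' hκt' U₂ hS₂).R₀) {t : ℝ} (ht : t ∈ Ico c'.alo (c'.alo + 1))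
    (hts : t ∉ Icc ((WallRef.UnitScale.toRailC Hb H₁ hf hεf hrf hκt U hρ4 hfar₁ hS₁ hW hclear U₂).w₁ hρ4') ((WallRef.UnitScale.toRailC Hb H₁ hf hεf hrf hκt U hρ4 hfar₁ hS₁ hW hclear U₂).w₂ hρ4')) :
    twOut₂ Hb H₁ Hball H₁all hsmall hf hεf hrf hκt U hρ4 hfar₁ hS₁ hfar₃ hS₃ hR0 hW hclear hBA hf' hεf' hrf' hκt' U₂ hρ4' hfar₂ hS₂ hR0' (circlePt t) = H₁.hostHyp.wallRef.bent U₂.hl₀ U₂.hrA (circlePt t) := by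
  rw [twOut₂, (twFrame₂ Hb H₁ Hball H₁all hsmall hf hεf hrf hκt U hρ4 hfar₁ hS₁ hfar₃ hS₃ hR0 hW hclear hBA hf' hεf' hrf' hκt' U₂ hρ4' hfar₂ hS₂ hR0').outKnot_circlePt_of_not_mem ht hts, baseKnot_twFrame₂]

/-- The twisted knot on the window. [folklore] -/
theorem coe_twOut₂_circlePt_of_mem (hR0' : R₀' ≤ (twData₂ Hb H₁ Hball H₁all hsmall hf hεf hrf hκt U hρ4 hfar₁ hS₁ hfar₃ hS₃ hR0 hW hclear hBA hf' hεf' hrf' hκt' U₂ hS₂).R₀) {s : ℝ}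
    (hs : s ∈ Icc ((WallRef.UnitScale.toRailC Hb H₁ hf hεf hrf hκt U hρ4 hfar₁ hS₁ hW hclear U₂).w₁ hρ4') ((WallRef.UnitScale.toRailC Hb H₁ hf hεf hrf hκt U hρ4 hfar₁ hS₁ hW hclear U₂).w₂ hρ4')) :
    ((twOut₂ Hb H₁ Hball H₁all hsmall hf hεf hrf hκt U hρ4 hfar₁ hS₁ hfar₃ hS₃ hR0 hW hclear hBA hf' hεf' hrf' hκt' U₂ hρ4' hfar₂ hS₂ hR0' (circlePt s) : 𝕊 3) : 𝔼 4) =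
      ((psiN.symm (H₁.hostHyp.wallRef.segO + (segData₂ Hb H₁ Hball H₁all hsmall hf hεf hrf hκt U hρ4 hfar₁ hS₁ hfar₃ hS₃ hR0 hW hclear hBA hf' hεf' hrf' hκt').L
        (psiN (H₁.hostHyp.wallRef.bent U₂.hl₀ U₂.hrA (circlePt s)) - H₁.hostHyp.wallRef.segO)) : 𝕊 3) : 𝔼 4) := by
  rw [twOut₂, (twFrame₂ Hb H₁ Hball H₁all hsmall hf hεf hrf hκt U hρ4 hfar₁ hS₁ hfar₃ hS₃ hR0 hW hclear hBA hf' hεf' hrf' hκt' U₂ hρ4' hfar₂ hS₂ hR0').coe_outKnot_circlePt_of_mem hs, TwData.Frame.Y, baseKnot_twFrame₂]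
  rfl

/-! ### The second output is the twisted rail bent knot -/

/-- **THE SECOND OUTPUT IS THE TWISTED RAIL BENT KNOT OF `c'`**, point for point. [folklore] -/
theorem outTwo_eq_twOut₂ (hR0' : R₀' ≤ (twData₂ Hb H₁ Hball H₁all hsmall hf hεf hrf hκt U hρ4 hfar₁ hS₁ hfar₃ hS₃ hR0 hW hclear hBA hf' hεf' hrf' hκt' U₂ hS₂).R₀) :
    outTwo Hb H₁ Hball H₁all hsmall hf hεf hrf hκt U hρ4 hfar₁ hS₁ hfar₃ hS₃ hR0 hW hclear hBA hf' hεf' hrf' hκt' U₂ hρ4' hfar₂ hS₂ = twOut₂ Hb H₁ Hball H₁all hsmall hf hεf hrf hκt U hρ4 hfar₁ hS₁ hfar₃ hS₃ hR0 hW hclear hBA hf' hεf' hrf' hκt' U₂ hρ4' hfar₂ hS₂ hR0' := by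
  have congr_bent : ∀ {t : ℝ}, t ∈ Icc (wallRefC Hb H₁ hf hεf hrf hκt U hρ4 hfar₁ hS₁ hW hclear).jLo (wallRefC Hb H₁ hf hεf hrf hκt U hρ4 hfar₁ hS₁ hW hclear).jHi →
      (wallRefC Hb H₁ hf hεf hrf hκt U hρ4 hfar₁ hS₁ hW hclear).bent U₂.hl₀ U₂.hrA (circlePt t) = H₁.hostHyp.wallRef.bent U₂.hl₀ U₂.hrA (circlePt t) := fun ht ↦
    c'.bentKnot_circlePt_congr_of_mem H₁.HU hW H₁.hostHyp.hW U₂.hl₀ U₂.hrA H₁.hB H₁.hAB ht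
  have congr_host : ∀ {t : ℝ}, t ∈ Icc (wallRefC Hb H₁ hf hεf hrf hκt U hρ4 hfar₁ hS₁ hW hclear).jLo (wallRefC Hb H₁ hf hεf hrf hκt U hρ4 hfar₁ hS₁ hW hclear).jHi →
      (wallRefC Hb H₁ hf hεf hrf hκt U hρ4 hfar₁ hS₁ hW hclear).host (circlePt t) = H₁.hostHyp.wallRef.host (circlePt t) := fun ht ↦
    Subtype.ext (by
      rw [WallRef.coe_host_circlePt, WallRef.coe_host_circlePt]
      exact c'.hostLoop_congr_of_mem H₁.HU hW H₁.hostHyp.hW WallRef.half_mem (by norm_num) WallRef.eighth_pos le_rfl H₁.hB H₁.hAB ht)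
  apply DFunLike.coe_injective
  funext u
  obtain ⟨t, ht, htu⟩ := (outTwo Hb H₁ Hball H₁all hsmall hf hεf hrf hκt U hρ4 hfar₁ hS₁ hfar₃ hS₃ hR0 hW hclear hBA hf' hεf' hrf' hκt' U₂ hρ4' hfar₂ hS₂).exists_mem_Ico_apply_circlePt_eq c'.alo
    (x := outTwo Hb H₁ Hball H₁all hsmall hf hεf hrf hκt U hρ4 hfar₁ hS₁ hfar₃ hS₃ hR0 hW hclear hBA hf' hεf' hrf' hκt' U₂ hρ4' hfar₂ hS₂ u) ⟨u, rfl⟩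
  have hu : circlePt t = u := (outTwo Hb H₁ Hball H₁all hsmall hf hεf hrf hκt U hρ4 hfar₁ hS₁ hfar₃ hS₃ hR0 hW hclear hBA hf' hεf' hrf' hκt' U₂ hρ4' hfar₂ hS₂).injective htu
  rw [← hu]
  obtain ⟨m1, m2, m3, m4, m5, m6⟩ := U₂.window_marks hρ4'
  by_cases hw : t ∈ Icc (U₂.w₁ hρ4') (U₂.w₂ hρ4')
  · -- on the window: the same unit point re-inserted by the same affine map
    have hc : t ∈ Icc (wallRefC Hb H₁ hf hεf hrf hκt U hρ4 hfar₁ hS₁ hW hclear).jLo (wallRefC Hb H₁ hf hεf hrf hκt U hρ4 hfar₁ hS₁ hW hclear).jHi :=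
      ⟨by linarith [hw.1, show (wallRefC Hb H₁ hf hεf hrf hκt U hρ4 hfar₁ hS₁ hW hclear).jLo = c'.juncLo (wallRefC Hb H₁ hf hεf hrf hκt U hρ4 hfar₁ hS₁ hW hclear).κ_pos (wallRefC Hb H₁ hf hεf hrf hκt U hρ4 hfar₁ hS₁ hW hclear).HU.cone.spike.seven_le_gapLo from rfl],
        by linarith [hw.2, show (wallRefC Hb H₁ hf hεf hrf hκt U hρ4 hfar₁ hS₁ hW hclear).jHi = c'.juncHi (wallRefC Hb H₁ hf hεf hrf hκt U hρ4 hfar₁ hS₁ hW hclear).κ_pos (wallRefC Hb H₁ hf hεf hrf hκt U hρ4 hfar₁ hS₁ hW hclear).HU.cone.spike.seven_le_gapHi from rfl]⟩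
    apply Subtype.ext
    rw [outTwo, U₂.coe_outOne_circlePt_of_mem (segData₂ Hb H₁ Hball H₁all hsmall hf hεf hrf hκt U hρ4 hfar₁ hS₁ hfar₃ hS₃ hR0 hW hclear hBA hf' hεf' hrf' hκt') rfl rfl rfl rfl (Psi₂_wallRefC_host Hb H₁ Hball H₁all hsmall hf hεf hrf hκt U hρ4 hfar₁ hS₁ hfar₃ hS₃ hR0 hW hclear hBA hf' hεf' hrf' hκt') hρ4' hfar₂ hS₂ hw,
      coe_twOut₂_circlePt_of_mem Hb H₁ Hball H₁all hsmall hf hεf hrf hκt U hρ4 hfar₁ hS₁ hfar₃ hS₃ hR0 hW hclear hBA hf' hεf' hrf' hκt' U₂ hρ4' hfar₂ hS₂ hR0' hw, congr_bent hc]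
    rfl
  · rw [outTwo, U₂.outOne_circlePt_of_not_mem (segData₂ Hb H₁ Hball H₁all hsmall hf hεf hrf hκt U hρ4 hfar₁ hS₁ hfar₃ hS₃ hR0 hW hclear hBA hf' hεf' hrf' hκt') rfl rfl rfl rfl (Psi₂_wallRefC_host Hb H₁ Hball H₁all hsmall hf hεf hrf hκt U hρ4 hfar₁ hS₁ hfar₃ hS₃ hR0 hW hclear hBA hf' hεf' hrf' hκt') hρ4' hfar₂ hS₂ ht hw,
      twOut₂_circlePt_of_not_mem Hb H₁ Hball H₁all hsmall hf hεf hrf hκt U hρ4 hfar₁ hS₁ hfar₃ hS₃ hR0 hW hclear hBA hf' hεf' hrf' hκt' U₂ hρ4' hfar₂ hS₂ hR0' ht hw]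
    by_cases hc : t ∈ Icc (wallRefC Hb H₁ hf hεf hrf hκt U hρ4 hfar₁ hS₁ hW hclear).jLo (wallRefC Hb H₁ hf hεf hrf hκt U hρ4 hfar₁ hS₁ hW hclear).jHi
    · rcases U₂.content_off_cases hρ4' hc hw with ⟨ρ, hρ, he⟩ | ⟨t', ht', he⟩
      · rw [he, ← congr_bent hc, he]
        exact (segData₂ Hb H₁ Hball H₁all hsmall hf hεf hrf hκt U hρ4 hfar₁ hS₁ hfar₃ hS₃ hR0 hW hclear hBA hf' hεf' hrf' hκt').seg ρ ⟨by rw [show (segData₂ Hb H₁ Hball H₁all hsmall hf hεf hrf hκt U hρ4 hfar₁ hS₁ hfar₃ hS₃ hR0 hW hclear hBA hf' hεf' hrf' hκt').ρlo = -1 from rfl]; exact hρ.1,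
          by rw [show (segData₂ Hb H₁ Hball H₁all hsmall hf hεf hrf hκt U hρ4 hfar₁ hS₁ hfar₃ hS₃ hR0 hW hclear hBA hf' hεf' hrf' hκt').ρhi = 1 / 2 from rfl]; exact hρ.2⟩
      · have hwh := c'.winHi_mem_core H₁.HU WallRef.half_mem
        have hjl := c'.juncLo_mem_core H₁.κ_pos H₁.h7
        obtain ⟨c1, c2, c3⟩ := c'.core_marks
        have hc2 : t' ∈ Icc (wallRefC Hb H₁ hf hεf hrf hκt U hρ4 hfar₁ hS₁ hW hclear).jLo (wallRefC Hb H₁ hf hεf hrf hκt U hρ4 hfar₁ hS₁ hW hclear).jHi :=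
          ⟨by linarith [ht'.1, show (wallRefC Hb H₁ hf hεf hrf hκt U hρ4 hfar₁ hS₁ hW hclear).jLo = c'.juncLo H₁.κ_pos H₁.h7 from rfl, hwh.1, hjl.2, c'.epsHi_bounds.1], ht'.2⟩
        rw [he, ← congr_bent hc, he, Psi₂_wallRefC_host Hb H₁ Hball H₁all hsmall hf hεf hrf hκt U hρ4 hfar₁ hS₁ hfar₃ hS₃ hR0 hW hclear hBA hf' hεf' hrf' hκt', congr_host hc2]
    · rw [(wallRefC Hb H₁ hf hεf hrf hκt U hρ4 hfar₁ hS₁ hW hclear).bent_of_not_mem U₂.hl₀ U₂.hrA ht hc, Psi₂_wallRefC_host Hb H₁ Hball H₁all hsmall hf hεf hrf hκt U hρ4 hfar₁ hS₁ hfar₃ hS₃ hR0 hW hclear hBA hf' hεf' hrf' hκt',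
        H₁.hostHyp.wallRef.bent_of_not_mem U₂.hl₀ U₂.hrA ht hc]

include hρ4' hfar₂ in
/-- **THE BENT KNOT OF `c'` OVER THE TRANSPORTED FRAME IS ISOTOPIC TO THE BENT KNOT OF `c'` OVER ITS
RAIL FRAME** (same unit scale). [cite: HirschDT1976, Ch. 8 §1, Thm. 1.3] -/
theorem isIsotopic_bentC_bentRail (hR0' : R₀' ≤ (twData₂ Hb H₁ Hball H₁all hsmall hf hεf hrf hκt U hρ4 hfar₁ hS₁ hfar₃ hS₃ hR0 hW hclear hBA hf' hεf' hrf' hκt' U₂ hS₂).R₀) :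
    ((wallRefC Hb H₁ hf hεf hrf hκt U hρ4 hfar₁ hS₁ hW hclear).bent U₂.hl₀ U₂.hrA).IsIsotopic (H₁.hostHyp.wallRef.bent U₂.hl₀ U₂.hrA) := by
  refine IsAmbientIsotopic.trans_holds (isIsotopic_bentC_outTwo Hb H₁ Hball H₁all hsmall hf hεf hrf hκt U hρ4 hfar₁ hS₁ hfar₃ hS₃ hR0 hW hclear hBA hf' hεf' hrf' hκt' U₂ hρ4' hfar₂ hS₂) ?_
  rw [outTwo_eq_twOut₂ Hb H₁ Hball H₁all hsmall hf hεf hrf hκt U hρ4 hfar₁ hS₁ hfar₃ hS₃ hR0 hW hclear hBA hf' hεf' hrf' hκt' U₂ hρ4' hfar₂ hS₂ hR0']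
  exact IsAmbientIsotopic.symm_holds (isIsotopic_bentRail_twOut₂ Hb H₁ Hball H₁all hsmall hf hεf hrf hκt U hρ4 hfar₁ hS₁ hfar₃ hS₃ hR0 hW hclear hBA hf' hεf' hrf' hκt' U₂ hρ4' hfar₂ hS₂ hR0')

end Two

end FlatHyp

end BandData

end Literature.Topology.FourManifolds
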